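import Summits.ABC.StewartYu.PadicG3TwoBudgetZBN
import Summits.ABC.StewartYu.PadicG3TwoBudgetK
import HarnessLib

/-!
# Cell abc-stewartyu, WP-L.P(2) (crux r4 `PadicCoreTwoRat`, stmt-ABC-20504), record: the k-step BUDGET LINES (L2₀)/(L2) of the
# schedule of record `schedTwoN` — the gain branches `Bw3N/(4·2^m)^{gain} < 1/KTwoSat` at the padded letter

`Summits/ABC/StewartYu/PadicG3TwoBudgetKN.lean` — cell `abc-stewartyu`, route `YuMatveevShapeRat`, seat p3 (g10; memo-13 §1, STATUS 20:34Z
design v3).  Theorems only (real arithmetic); twin of p3-g6's `PadicG3TwoBudgetK` on the `𝔑`-threaded schedule `schedTwoN`.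

THE COMPARISON (unit `Z = G·X·L`, `G = (m+2)·log 2`; `n = d+1 ≥ 2`).  COST of a k-step at level `I ≤ I*N`, point `|x₁| ≤ Nsub3N I (k+1)`,
multi-index of total order `≤ T03N 0`: `log Bw3N + log KTwoSat ≤ (289/64)·Z + FH` (`cost_leN`), where the slots are the landed atoms —
weights `log Bw3N ≤ (9/64)Z + G` (`PadicG3TwoBudgetZN`), the box count `log cardBN ≤ Z/128 + Z/2^29 + 1` twice (`log_cardBN_le_Z`, at a letter
`P.W ≥ c_W(d)` which absorbs the Hermite `(d+1)(d+2)·log(d+1)`), the Fel'dman sizes `≤ (5/4)Z + 2G + 25(n+1)` twice (Siegel level and step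
level), the directional lines `≤ (21/32)Z` twice (`PadicG3TwoBudgetZBN`, padded letter), the level-`0` Siegel far height `≤ (17/32)Z`, the slop
`8ΣA ≤ Z/2^15` twice, and the step's far height `FH = 4|x₁|·hboxvN (2A) I ≤ (25/16)·3ᵏ·Z` (`I = 0`) resp. `(25/8)·3ᵏ·Z` (`I ≥ 1`).  GAIN:
level `0` (all nodes, `gainExpA`) `≥ (15/2)·3ᵏ·Z` (`gainA_geN`); levels `I ≥ 1` (`gainExp`) `≥ (247/18)·Z` (`k = 0`), `≥ (247/36)·3ᵏ·Z` (`k ≥ 1`)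
(`gain_geN`; `Xs3N·T3N ≥ (247/72)·XL` at EVERY level, no depth hypothesis).  Hence **`hL2zero_gain_schedTwoN`** and **`hL2_gain_schedTwoN`**
— the first two conjuncts of `LinesSupplyTwoNW` for every ledger `P` with `G = (m+2)·log 2`, `2G ≤ yload`, `N_q = 2^{m+2}`, floor `Aⱼ ≥ 1`,
`N ≤ (2/log 2)ⁿ·Ω`, weights `h(αoⱼ) ≤ 2Aⱼ`, coefficients `|ballₖ| ≤ (d+1)(d+1)!·N·e^{W₀}` with `W₀ + c_W(d) ≤ P.W` and `c_W(d) ≤ P.W`.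

WHAT THIS IS NOT: the third step (L3) (sequel `PadicG3TwoBudgetTN`), the count (L1N), the instantiation at `parTwo`; no crux moves.

References: Yu. V. Nesterenko, LNM 1819 (2003), §4.2 (4.24)–(4.35), Cor. 4.5; K. Yu, Acta Math. 211 (2013), Lemma 5.2 (5.28)–(5.41).
-/

noncomputable section

open Finset Real
open scoped Nat
open Literature.NumberTheory.Transcendental
open Literature.NumberTheory.Transcendental.CW77.Setup (Tau tauNorm)

namespace Summit.ABC.StewartYu

namespace TwoSetup

open Summit.ABC.StewartYu.G3Boxes Summit.ABC.StewartYu.PadicG3Par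

variable (S : TwoSetup) (F : S.SatData) (P : PadicG3Par (S.d + 1))

/-! ### The box count in the budget unit -/

/-- `(2d+5)·log(d+1) ≤ c_W(d)`. [folklore] -/
theorem log_le_cW (d : ℕ) : (2 * (d : ℝ) + 5) * Real.log ((d : ℝ) + 1) ≤ (cW d : ℝ) := by
  unfold cW; push_cast
  have h0 : (0 : ℝ) ≤ d := Nat.cast_nonneg _
  have hlog : Real.log ((d : ℝ) + 1) ≤ (d : ℝ) + 1 - 1 := Real.log_le_sub_one_of_pos (by positivity)
  have hl0 : 0 ≤ Real.log ((d : ℝ) + 1) := Real.log_nonneg (by linarith)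
  nlinarith

set_option maxHeartbeats 400000 in
/-- **`log cardBN ≤ Z/128 + Z/2^29 + 1`** at a letter `P.W ≥ c_W(d)` (`log(L₀+1) ≤ L₀ ≤ Z/(8G) + 1`, `G ≥ 16`; the Hermite
`(d+1)(d+2)·log(d+1) ≤ (d+1)·c_W(d)/2 ≤ (d+1)·W_L/2`, `2(d+1)·log L ≤ 2(d+1)·W_L`, `(d+2)·L·W_L ≤ Z/64`). [folklore] -/
theorem log_cardBN_le_Z (hy : 2 * P.G ≤ P.yload) (hA1 : ∀ j, 1 ≤ P.A j)
    (hN : (F.N : ℝ) ≤ (2 / Real.log 2) ^ (S.d + 1) * P.Ω) (hcW : (cW S.d : ℝ) ≤ P.W) :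
    Real.log (S.cardBN F P : ℝ) ≤ (P.G * P.X * P.L) / 128 + (P.G * P.X * P.L) / 2 ^ 29 + 1 := by
  obtain ⟨hX36, hG8, hL25, hLG, hLL, hLH, hXL⟩ := S.base_facts P
  obtain ⟨hL₀G, hL₀N⟩ := S.L₀_facts P hy
  have hc := S.log_cardBN_le F P hA1 hN
  set Z : ℝ := P.G * P.X * P.L with hZ
  have hd0 : (0 : ℝ) ≤ (S.d : ℝ) := by positivity
  have hGpos : 0 < P.G := by linarith [P.eight_le_G]
  have hG16 : 16 ≤ P.G := by linarith
  have hL1 : (1 : ℝ) ≤ P.L := P.one_le_L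
  have hZ0 : 0 ≤ Z := by rw [hZ]; have := P.GXL_ge; linarith [show (0:ℝ) ≤ 16*72*2^25 by positivity]
  -- `log(L₀+1) ≤ L₀ ≤ Z/128 + 1`
  have h1 : Real.log ((P.L₀ : ℝ) + 1) ≤ Z / 128 + 1 := by
    have hl : Real.log ((P.L₀ : ℝ) + 1) ≤ P.L₀ := by
      have := Real.log_le_sub_one_of_pos (show (0 : ℝ) < P.L₀ + 1 by positivity); linarith
    have h2 : ((P.L₀ : ℝ) - 1) * P.G ≤ Z / 8 := by linarith
    have h3 : ((P.L₀ : ℝ) - 1) * 16 ≤ Z / 8 := by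
      rcases le_or_gt 1 (P.L₀ : ℝ) with h | h
      · exact le_trans (mul_le_mul_of_nonneg_left hG16 (by linarith)) h2
      · linarith
    linarith
  -- the Hermite and the `log L` terms against `W_L`
  have hWL := P.WL_mul_le
  have hlogL := P.log_L_le_WL
  have hWle : P.W ≤ P.WL := by
    have h := P.W_add_log_le_WL
    have : 0 ≤ Real.log (2 * (P.L : ℝ)) := Real.log_nonneg (by linarith)
    linarith
  have hcw := log_le_cW S.d
  have hl0 : 0 ≤ Real.log ((S.d : ℝ) + 1) := Real.log_nonneg (by linarith)
  have h4 : ((S.d : ℝ) + 2) * Real.log ((S.d : ℝ) + 1) ≤ P.WL / 2 := by nlinarith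
  have h5 : ((S.d : ℝ) + 1) * (((S.d : ℝ) + 2) * Real.log ((S.d : ℝ) + 1) + 2 * Real.log P.L) ≤
      ((S.d : ℝ) + 1) * ((5 / 2) * P.WL) := by
    refine mul_le_mul_of_nonneg_left ?_ (by linarith)
    linarith
  have h6 : ((S.d : ℝ) + 1) * ((5 / 2) * P.WL) ≤ Z / 2 ^ 29 := by
    -- `(d+1)·W_L ≤ (d+2)·L·W_L / L ≤ Z/(64 L) ≤ Z/2^31`
    have hWL' : (((S.d + 1 : ℕ) : ℝ) + 1) * P.L * P.WL ≤ Z / 64 := by rw [hZ]; exact hWL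
    push_cast at hWL'
    have hWL0 : 0 ≤ P.WL := by linarith [P.WL_ge_one]
    have h7 : ((S.d : ℝ) + 1) * P.WL * 2 ^ 25 ≤ (((S.d : ℝ) + 1) + 1) * P.L * P.WL := by
      have := mul_le_mul_of_nonneg_left hL25 (by positivity : (0 : ℝ) ≤ ((S.d : ℝ) + 1) * P.WL)
      nlinarith
    rw [le_div_iff₀ (by positivity)]
    nlinarith
  linarith

/-! ### The cost of a k-step -/

/-- **THE COST OF A k-STEP** of `schedTwoN`: `log Bw3N + log KTwoSat I x τ ≤ (289/64)·Z + 4|x|·hboxvN (2A) I` for `I ≤ I*N`, `k < d+3`,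
`|x| ≤ Nsub3N I (k+1)`, `tauNorm τ ≤ T03N 0`, at the padded letter. [cite: Nesterenko2003, §4.2 (4.24)–(4.35); shape only] -/
theorem cost_leN (hG : P.G = (P.m + 2) * Real.log 2) (hy : 2 * P.G ≤ P.yload) (hNq : P.Nq = 2 ^ (P.m + 2))
    (hA1 : ∀ j, 1 ≤ P.A j) (hN : (F.N : ℝ) ≤ (2 / Real.log 2) ^ (S.d + 1) * P.Ω)
    (hVo : ∀ j, Height.logHeight₁ (F.αo j) ≤ 2 * P.A j) {W₀ : ℝ}
    (hball : ∀ k, (|S.ball k| : ℝ) ≤ (((S.d + 1) * (S.d + 1)! : ℕ) : ℝ) * F.N * Real.exp W₀)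
    (hpad : W₀ + (cW S.d : ℝ) ≤ P.W) (hcW : (cW S.d : ℝ) ≤ P.W)
    {I : ℕ} (hI : I ≤ S.Istar3N F P) {k : ℕ} (hk : k < S.d + 3) {x : ℤ}
    (hx : |x| ≤ (S.Nsub3N P I (k + 1) : ℤ)) {τ : Tau S.d} (hτ : tauNorm τ ≤ S.T03N F P 0) :
    Real.log (S.Bw3N F P) + Real.log (KTwoSat (S.schedTwoN F P) F (S.Bv3N F P) I x τ) ≤
      (289 / 64) * (P.G * P.X * P.L) + 4 * |(x : ℝ)| * S.hboxvN F P (fun j => 2 * P.A j) I := by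
  obtain ⟨hGZ, hNZ, h1Z⟩ := S.smalls_le_Z P
  have hX9 := P.X_le_nine_H
  have hHpos : (0 : ℝ) < P.H := by have : 1 ≤ P.H := le_max_left _ _; exact_mod_cast this
  -- the slots
  have hK := S.log_KTwoSat_schedTwoN_le F P (Vo := fun j => 2 * P.A j) hVo I x τ
  have hBw := S.log_Bw3N_le_Z F P hG hy
  have hc := S.log_cardBN_le_Z F P hy hA1 hN hcW
  have hAmax := S.log_Amax3N_le F P (Vo := fun j => 2 * P.A j) hVo
  have hM₀E := S.log_M₀E3N_le F P
  have hfar0 := S.siegel_far_le_Z F P hA1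
  have hVoZ := S.sum_Vo_le_Z P hA1
  -- the level-`0` Fel'dman size
  have hF0 : Real.log (S.feldSizeN F P 0 P.X (S.T03N F P 0)) ≤
      (5 / 4) * (P.G * P.X * P.L) + 2 * P.G + 25 * ((S.d : ℝ) + 1 + 1) := by
    refine S.log_feldSizeN_le_Z F P hG hy hNq hN 0 (by positivity) (k := 0) (by omega) ?_ le_rfl
    rw [Nat.sub_zero, pow_zero, mul_one]
    have h3 : (0 : ℝ) ≤ (3 : ℝ) ^ S.Istar3N F P := by positivity
    calc (3 : ℝ) ^ S.Istar3N F P * (P.X : ℝ) ≤ (3 : ℝ) ^ S.Istar3N F P * (9 * P.H) := mul_le_mul_of_nonneg_left hX9 h3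
      _ = 9 * (3 : ℝ) ^ S.Istar3N F P * P.H := by ring
  -- the level-`0` directional line
  have hXb0 : (S.T03N F P 0 : ℝ) * Real.log (S.Xb3N F P 0 : ℝ) ≤ (21 / 32) * (P.G * P.X * P.L) :=
    S.mul_log_Xb3N_le_Z F P hNq hA1 hN hball hpad 0 le_rfl
  -- order bounds of the multi-index
  have ht1 : τ.1 ≤ S.T03N F P 0 := le_trans (by unfold tauNorm; omega) hτ
  have ht2 : ((∑ j, τ.2 j : ℕ) : ℝ) ≤ S.T03N F P 0 := by
    have : ∑ j, τ.2 j ≤ S.T03N F P 0 := le_trans (by unfold tauNorm; omega) hτ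
    exact_mod_cast this
  -- the step's Fel'dman size at `r = |x| ≤ 3^{k+1}·Xs3N I < 3^{k+1}·3^I·X ≤ 3^{k+1}·3^I·9H`
  have hNs : S.Nsub3N P I (k + 1) = 3 ^ (k + 1) * S.Xs3N P I := by unfold Nsub3N; rw [if_neg (by omega)]
  have hx' : |(x : ℝ)| ≤ (3 : ℝ) ^ (k + 1) * (S.Xs3N P I : ℝ) := by
    have : ((|x| : ℤ) : ℝ) ≤ (((S.Nsub3N P I (k + 1) : ℕ) : ℤ) : ℝ) := by exact_mod_cast hx
    rw [hNs] at this; push_cast at this; exact this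
  have hFI : Real.log (S.feldSizeN F P I |(x : ℝ)| τ.1) ≤
      (5 / 4) * (P.G * P.X * P.L) + 2 * P.G + 25 * ((S.d : ℝ) + 1 + 1) := by
    refine S.log_feldSizeN_le_Z F P hG hy hNq hN I (abs_nonneg _) (k := k + 1) (by omega) ?_ ht1
    have hXs := (S.Xs3N_lt P I).le
    have h3I : (0 : ℝ) ≤ (3 : ℝ) ^ (S.Istar3N F P - I) := by positivity
    have h1 : |(x : ℝ)| ≤ (3 : ℝ) ^ (k + 1) * ((3 : ℝ) ^ I * (9 * P.H)) :=
      hx'.trans (mul_le_mul_of_nonneg_left (hXs.trans (mul_le_mul_of_nonneg_left hX9 (by positivity)))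
        (by positivity))
    have e3 : (3 : ℝ) ^ (S.Istar3N F P - I) * (3 : ℝ) ^ I = (3 : ℝ) ^ S.Istar3N F P := by
      rw [← pow_add, Nat.sub_add_cancel hI]
    have e : (3 : ℝ) ^ (S.Istar3N F P - I) * ((3 : ℝ) ^ (k + 1) * ((3 : ℝ) ^ I * (9 * P.H))) =
        9 * (3 : ℝ) ^ S.Istar3N F P * (3 : ℝ) ^ (k + 1) * P.H := by
      calc (3 : ℝ) ^ (S.Istar3N F P - I) * ((3 : ℝ) ^ (k + 1) * ((3 : ℝ) ^ I * (9 * P.H)))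
          = ((3 : ℝ) ^ (S.Istar3N F P - I) * (3 : ℝ) ^ I) * (3 : ℝ) ^ (k + 1) * (9 * P.H) := by ring
        _ = 9 * (3 : ℝ) ^ S.Istar3N F P * (3 : ℝ) ^ (k + 1) * P.H := by rw [e3]; ring
    rw [← e]
    exact mul_le_mul_of_nonneg_left h1 h3I
  -- the step's directional line
  have hXbI : ((∑ j, τ.2 j : ℕ) : ℝ) * Real.log (S.Xb3N F P I : ℝ) ≤ (21 / 32) * (P.G * P.X * P.L) :=
    S.mul_log_Xb3N_le_Z F P hNq hA1 hN hball hpad I ht2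
  have hlog2 := log_two_le
  -- assemble
  linarith only [hK, hBw, hc, hAmax, hM₀E, hF0, hXb0, hfar0, hVoZ, hFI, hXbI, hGZ, hNZ, h1Z, hlog2]

/-! ### The gains -/

/-- **Gain at level `0`** (all nodes): `gainExpA σ 0 k · G ≥ (15/2)·3ᵏ·Z` (`T3N 0 = 4L`, `Nsub3N 0 0 = X`, `Nsub3N 0 k = 3ᵏ·Xs3N 0 ≥
3ᵏ·(31/33)X`). [cite: Nesterenko2003, §4 (4.3); shape only] -/
theorem gainA_geN (k : ℕ) :
    (15 / 2) * (3 : ℝ) ^ k * (P.G * P.X * P.L) ≤ (gainExpA (S.schedTwoN F P) 0 k : ℝ) * P.G := by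
  obtain ⟨hX36, hG8, hL25, hLG, hLL, hLH, hXL⟩ := S.base_facts P
  have hGpos : 0 < P.G := by linarith [P.eight_le_G]
  have hT : S.T3N P 0 = 4 * P.L := S.T3N_zero P
  unfold gainExpA
  rw [schedTwoN_Nsub, schedTwoN_tdec, hT]
  have hX0 : (0 : ℝ) ≤ P.X := by positivity
  have hL0 : (0 : ℝ) ≤ P.L := by positivity
  rcases Nat.eq_zero_or_pos k with rfl | hk
  · rw [Nsub3N_zero_zero]; push_cast; nlinarith
  · have hN : S.Nsub3N P 0 k = 3 ^ k * S.Xs3N P 0 := by unfold Nsub3N; rw [if_neg (by omega)]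
    rw [hN]; push_cast
    have hXs := S.Xs3N_zero_ge P
    have h3 : (0 : ℝ) ≤ (3 : ℝ) ^ k := by positivity
    have h1 : (3 : ℝ) ^ k * ((31 / 33) * P.X) ≤ (3 : ℝ) ^ k * (S.Xs3N P 0 : ℝ) := mul_le_mul_of_nonneg_left hXs h3
    have h2 : (15 / 2) * (3 : ℝ) ^ k * (P.G * P.X * P.L) ≤ 8 * ((3 : ℝ) ^ k * ((31 / 33) * P.X)) * P.L * P.G := by
      nlinarith [mul_nonneg (mul_nonneg h3 hX0) (mul_nonneg hL0 hGpos.le)]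
    nlinarith [mul_nonneg h3 hX0, mul_nonneg hL0 hGpos.le,
      mul_nonneg (mul_nonneg h3 (by positivity : (0:ℝ) ≤ S.Xs3N P 0)) (mul_nonneg hL0 hGpos.le)]

/-- **Gain at level `I ≥ 1`**: `gainExp σ I k · G ≥ (247/18)·Z` (`k = 0`, coprime nodes `3·Xs3N − Xs3N`), `≥ (247/36)·3ᵏ·Z` (`k ≥ 1`);
`Xs3N·T3N ≥ (247/72)·XL` at every level. [cite: Yu2013, Lemma 5.2 (5.27); shape only] -/
theorem gain_geN {I : ℕ} (hI : 1 ≤ I) (k : ℕ) :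
    (if k = 0 then (247 / 18 : ℝ) else (247 / 36) * (3 : ℝ) ^ k) * (P.G * P.X * P.L) ≤
      (gainExp (S.schedTwoN F P) I k : ℝ) * P.G := by
  have hGpos : 0 < P.G := by linarith [P.eight_le_G]
  have hXT := S.Xs3N_mul_T3N_ge P I
  have hI0 : I ≠ 0 := by omega
  unfold gainExp
  rw [schedTwoN_Nsub, schedTwoN_tdec]
  rcases Nat.eq_zero_or_pos k with rfl | hk
  · simp only [if_true]
    have hN : S.Nsub3N P I 0 = 3 * S.Xs3N P I := by unfold Nsub3N; simp [hI0]
    rw [hN, Nat.mul_div_cancel_left _ (by norm_num : 0 < 3)]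
    have e : (2 * (3 * S.Xs3N P I - S.Xs3N P I) * S.T3N P I : ℕ) = 4 * (S.Xs3N P I * S.T3N P I) := by
      rw [show 3 * S.Xs3N P I - S.Xs3N P I = 2 * S.Xs3N P I by omega]; ring
    rw [e]; push_cast
    nlinarith
  · rw [if_neg (by omega), if_neg (by omega)]
    have hN : S.Nsub3N P I k = 3 ^ k * S.Xs3N P I := by unfold Nsub3N; rw [if_neg (by omega)]
    rw [hN]; push_cast
    have h3 : (0 : ℝ) ≤ (3 : ℝ) ^ k := by positivity
    have hX0 : (0 : ℝ) ≤ (S.Xs3N P I : ℝ) := by positivity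
    have hT0 : (0 : ℝ) ≤ (S.T3N P I : ℝ) := by positivity
    have h1 : (3 : ℝ) ^ k * ((247 / 72) * P.X * P.L) ≤ (3 : ℝ) ^ k * ((S.Xs3N P I : ℝ) * (S.T3N P I : ℝ)) :=
      mul_le_mul_of_nonneg_left hXT h3
    nlinarith [mul_nonneg (mul_nonneg h3 (mul_nonneg hX0 hT0)) hGpos.le, mul_nonneg hT0 hGpos.le]

/-! ### The budget lines -/

/-- **(L2₀) THE k-STEP GAIN BRANCHES OF `schedTwoN` AT LEVEL `0`** (all nodes; budget `≥ (15/2)·3ᵏ·Z` against cost `≤ (289/64)·Z +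
(25/16)·3ᵏ·Z`) — the first conjunct of `LinesSupplyTwoNW`, for every admissible ledger. [cite: Nesterenko2003, §4.2 Cor 4.5]
[cite: Yu2013, Lemma 5.2 (5.28)–(5.31)] -/
theorem hL2zero_gain_schedTwoN (hG : P.G = (P.m + 2) * Real.log 2) (hy : 2 * P.G ≤ P.yload) (hNq : P.Nq = 2 ^ (P.m + 2))
    (hA1 : ∀ j, 1 ≤ P.A j) (hN : (F.N : ℝ) ≤ (2 / Real.log 2) ^ (S.d + 1) * P.Ω)
    (hVo : ∀ j, Height.logHeight₁ (F.αo j) ≤ 2 * P.A j) {W₀ : ℝ}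
    (hball : ∀ k, (|S.ball k| : ℝ) ≤ (((S.d + 1) * (S.d + 1)! : ℕ) : ℝ) * F.N * Real.exp W₀)
    (hpad : W₀ + (cW S.d : ℝ) ≤ P.W) (hcW : (cW S.d : ℝ) ≤ P.W) :
    ∀ k, k < S.d + 3 → ∀ x₁ : ℤ, |x₁| ≤ (S.Nsub3N P 0 (k + 1) : ℤ) → ∀ τ : Tau S.d,
      tauNorm τ + S.T3N P 0 ≤ S.T03N F P 0 - k * S.T3N P 0 →
      S.Bw3N F P / (4 * (2 : ℝ) ^ P.m) ^ gainExpA (S.schedTwoN F P) 0 k <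
        1 / KTwoSat (S.schedTwoN F P) F (S.Bv3N F P) 0 x₁ τ := by
  intro k hk x₁ hx₁ τ hτ
  have hτ' : tauNorm τ ≤ S.T03N F P 0 := by omega
  refine branch_gain_lt_of_log (S.Bw3N_pos F P) (S.KTwoSat_schedTwoN_pos F P 0 x₁ τ) (by positivity) ?_
  rw [S.log_rho_eq_G P hG]
  have hc := S.cost_leN F P hG hy hNq hA1 hN hVo hball hpad hcW (Nat.zero_le _) hk hx₁ hτ'
  have hf := S.far0_le_Z F P hA1 hx₁
  have hg := S.gainA_geN F P k
  have hZ : (0 : ℝ) < P.G * P.X * P.L := by have := P.GXL_ge; linarith [show (0:ℝ) < 16*72*2^25 by positivity]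
  have h3 : (1 : ℝ) ≤ (3 : ℝ) ^ k := one_le_pow₀ (by norm_num)
  nlinarith [mul_le_mul_of_nonneg_right h3 hZ.le]

/-- **(L2) THE k-STEP GAIN BRANCHES OF `schedTwoN` AT LEVELS `1 ≤ I ≤ I*N`** (coprime first sub-step; budget `≥ (247/18)·Z` resp.
`(247/36)·3ᵏ·Z` against cost `≤ (289/64)·Z + (25/8)·3ᵏ·Z`) — the second conjunct of `LinesSupplyTwoNW`, for every admissible ledger; no
depth hypothesis (`T3N ≥ 8` is built into the schedule). [cite: Nesterenko2003, §4.2 Cor 4.5] [cite: Yu2013, Lemma 5.2 (5.28)–(5.31)] -/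
theorem hL2_gain_schedTwoN (hG : P.G = (P.m + 2) * Real.log 2) (hy : 2 * P.G ≤ P.yload) (hNq : P.Nq = 2 ^ (P.m + 2))
    (hA1 : ∀ j, 1 ≤ P.A j) (hN : (F.N : ℝ) ≤ (2 / Real.log 2) ^ (S.d + 1) * P.Ω)
    (hVo : ∀ j, Height.logHeight₁ (F.αo j) ≤ 2 * P.A j) {W₀ : ℝ}
    (hball : ∀ k, (|S.ball k| : ℝ) ≤ (((S.d + 1) * (S.d + 1)! : ℕ) : ℝ) * F.N * Real.exp W₀)
    (hpad : W₀ + (cW S.d : ℝ) ≤ P.W) (hcW : (cW S.d : ℝ) ≤ P.W) :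
    ∀ I, 1 ≤ I → I ≤ S.Istar3N F P → ∀ k, k < S.d + 3 → ∀ x₁ : ℤ, |x₁| ≤ (S.Nsub3N P I (k + 1) : ℤ) →
      ∀ τ : Tau S.d, tauNorm τ + S.T3N P I ≤ S.T03N F P I - k * S.T3N P I →
      S.Bw3N F P / (4 * (2 : ℝ) ^ P.m) ^ gainExp (S.schedTwoN F P) I k <
        1 / KTwoSat (S.schedTwoN F P) F (S.Bv3N F P) I x₁ τ := by
  intro I hI1 hI k hk x₁ hx₁ τ hτ
  have hτ' : tauNorm τ ≤ S.T03N F P 0 := le_trans (by omega) (S.T03N_le_zero F P I)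
  refine branch_gain_lt_of_log (S.Bw3N_pos F P) (S.KTwoSat_schedTwoN_pos F P I x₁ τ) (by positivity) ?_
  rw [S.log_rho_eq_G P hG]
  have hc := S.cost_leN F P hG hy hNq hA1 hN hVo hball hpad hcW hI hk hx₁ hτ'
  have hf := S.farI_le_Z F P hA1 hI1 hx₁
  have hg := S.gain_geN F P hI1 k
  have hZ : (0 : ℝ) < P.G * P.X * P.L := by have := P.GXL_ge; linarith [show (0:ℝ) < 16*72*2^25 by positivity]
  rcases Nat.eq_zero_or_pos k with rfl | hk0
  · simp only [if_true, pow_zero] at hg hf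
    linarith
  · rw [if_neg (by omega)] at hg
    have h33 : (3 : ℝ) ≤ (3 : ℝ) ^ k := by
      calc (3 : ℝ) = 3 ^ 1 := by norm_num
        _ ≤ 3 ^ k := pow_le_pow_right₀ (by norm_num) hk0
    nlinarith [mul_le_mul_of_nonneg_right h33 hZ.le]

/-- **The sharp level-`0`, `k = 0` gain**: `8·Z ≤ gainExpA σ 0 0 · G` (`(2X+1)·4L·G`). [cite: Nesterenko2003, §4 (4.3); shape only] -/
theorem gainA_geN_zero : 8 * (P.G * P.X * P.L) ≤ (gainExpA (S.schedTwoN F P) 0 0 : ℝ) * P.G := by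
  have hGpos : 0 < P.G := by linarith [P.eight_le_G]
  have hT : S.T3N P 0 = 4 * P.L := S.T3N_zero P
  unfold gainExpA
  rw [schedTwoN_Nsub, schedTwoN_tdec, hT, Nsub3N_zero_zero]
  push_cast
  have hX0 : (0 : ℝ) ≤ P.X := by positivity
  have hL0 : (0 : ℝ) ≤ P.L := by positivity
  nlinarith [mul_nonneg hL0 hGpos.le]

end TwoSetup

end Summit.ABC.StewartYu

end
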